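import Literature.Probability.RandomPlanarGeometry.HexSAWStripSurfaceGrowth
import Literature.Probability.RandomPlanarGeometry.HexSAWStripSurfaceLimits
import HarnessLib

/-!
# The top-level growth rate `ν_T(y)` against the strip threshold `y_T`: `ν_T(y) < x_c⁻¹ ⇒ y ≤ y_T`, and
# `B_h(x_c; y) < ∞ (h ≤ T) ⇒ ν_T(y) ≤ x_c⁻¹` (BBdGDCG14, Corollary 8 — the two comparison directions, weak forms)

Topic `Literature/Probability/RandomPlanarGeometry` (continues `HexSAWStripSurfaceGrowth.lean` — `HV.stripChains`, `HV.stripZL`,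
`HV.stripNu T y = ν_T(y)`, `HV.tendsto_stripZL_rpow`, `HV.pow_stripNu_le` — and the capstone chain `HexSAWSurfaceFugacity.lean` /
`HexSAWStripSurfaceLimits.lean`: `HV.stripBddSet T`, `HV.stripYT T = y_T`, `HV.le_stripYT`, `HV.stripGFy_nonneg'`; uses the tree's
`HV.stripGFy_beta_eq_sum_bridgeLists` (`HexSAWStripSurfaceArchCut.lean`), `HV.mem_bridgeLists_iff` (`HexSAWLowerBound.lean`),
`HV.summable_stripCount_mul_pow` and `HV.toPair` (`HexSAWStripPairsTransfer.lean`), `HV.lastArgmin/lastArgmax`,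
`HV.mem_stripV_of_bounds` (`HexSAWBridges.lean`)).  Source: N. R. Beaton, M. Bousquet-Mélou, J. de Gier, H. Duminil-Copin,
A. J. Guttmann, *The critical fugacity for surface adsorption of self-avoiding walks on the honeycomb lattice is `1 + √2`*, Comm.
Math. Phys. 326 (2014) 727–754, arXiv:1109.0358v5, Corollary 8 (p. 12): "Let `y > 0`. The series `A_T(x,y)`, `B_T(x,y)` and `C_T(x,y)`
all have the same radius of convergence, `ρ_T(y) = 1/μ_T(1,y)` … There exists a unique `y_T > 0` such that `ρ_T(y_T) = x_c := 1/μ`.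
The series (in `y`) `A_T(x_c,y)`, `B_T(x_c,y)` and `C_T(x_c,y)` have radius of convergence `y_T`", with the proof sentences "By
definition of `ρ_T`, the series `C_T(x_c,y)` converges if `x_c < ρ_T(y)`, and diverges if `x_c > ρ_T(y)`" (p. 13).  Printed
mechanism: unfolding (Hammersley–Torrie–Whittington) gives bridges, arches and all walks the same growth rate.  MECHANISM HERE
(the lane's, different): (b) every bridge of `S_{T,L}` IS a strip chain, so `B_{T,L}(x_c;y) ≤ Σ_n x_c^{n+1} Z_n(y)`, summable when
`ν_T(y) < x_c⁻¹`; (a) conversely a FINITE bridge decomposition INSIDE the strip: cut a strip chain at its last lowest vertex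
(two bottomed pieces) and each bottomed piece at its last top vertex (a weak bridge to the top level, which after a vertical
shift — and one extra bottom step for a type-`1` start — is a bridge of a LOWER strip `S_{T−j}` carrying all the top weight, plus an
unweighted remainder controlled by the strip sub-criticality `Σ_k c_k(S_{T−1}) x_c^k < ∞`); hence `Σ_n x_cⁿ Z_n(y)` is bounded as
soon as every `B_h(x_c;y)`, `h ≤ T`, is, and `ν_T(y) ≤ x_c⁻¹`.

## Main statements (namespace `Literature.Probability.RandomPlanarGeometry.SAW.HV`, all proved; `T ≥ 1`, `y > 0`)

* `stripGFy_beta_le_sum_stripZL` (`B_{T,L}(x_c;y) ≤ Σ_{n<|V(S_{T,L})|} x_c^{n+1} Z_n(y)`), `summable_pow_mul_stripZL`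
  (`ν_T(y) < x_c⁻¹ ⇒` summable), **`mem_stripBddSet_of_stripNu_lt`** (`ν_T(y) < x_c⁻¹ ⇒ y ∈ stripBddSet T`),
  **`inv_le_stripNu_of_stripYT_lt`** (`y_T < y ⇒ x_c⁻¹ ≤ ν_T(y)`);
* the decomposition: `wgt`, `allTo/upTo/wbTo`, `lowFst/lowSnd/lowGlue` (`sum_allTo_wgt_le`), `topBr/topRest/topGlue`
  (`sum_upTo_wgt_le`), `shift_mem_bridgeLists_false`, `cons_shift_mem_bridgeLists_true` (`sum_wbTo_wgt_le`), `G0`,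
  `card_stripChains_le`, `sum_allTo_pow_le`;
* **`sum_pow_mul_stripZL_le`** (uniform bound `Σ_{n≤N} x_cⁿ Z_n(y) ≤ max(1,y⁻¹)(2T G₀ (1 + 2T(x_c⁻¹+x_c⁻²)K))²` when
  `B_{h,L}(x_c;y) ≤ K`, `1 ≤ h ≤ T`), **`stripNu_le_inv_of_bdd`**, **`stripNu_le_inv_of_mem`**
  (`(∀ h ≤ T, y ∈ stripBddSet h) ⇒ ν_T(y) ≤ x_c⁻¹`).

The identification at the threshold (`ν_T(y_T) = x_c⁻¹`) and the strictness consequences are `HexSAWStripSurfaceThresholdRate.lean`.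
Label: CONSOLIDATION BY A DIFFERENT PROOF, weak form, of Corollary 8's comparison `x_c ≶ ρ_T(y) ⟺ y ≷ y_T` for the lane's
`y_T` and the translation-class rate `ν_T`; no identification with the printed rooted series is asserted.  Lane «pcv-sawmu», a-p2 g10.

Editions and consumers (lane «pcv-sawmu»).  ed.1 036e2dff (HOME, a-p2 g10); ed.2 759e1662928958a0 = ed.1 + lit-2 g17's locator tokens
(docstring-only), landed as p373451 (2026-08-23, filer a-p2 g11); ed.3 (a-p2 g14, 2026-08-24) = ed.2 + this paragraph (no code change).
Consumers: the lane's «THRESHOLD+» car `HexSAWStripSurfaceThresholdRate.lean` (uses `inv_le_stripNu_of_stripYT_lt`,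
`mem_stripBddSet_of_stripNu_lt`, `stripNu_le_inv_of_mem`, `summable_pow_mul_stripZL`, `sum_pow_mul_stripZL_le` and the decomposition
`wgt` / `allTo` / `upTo` / `wbTo` / `G0` / `brTerm` for the identification `ν_T(y_T) = x_c⁻¹` and the divergence rate at `y_T`) and a-idea-1's
«QUANT-ONSET» car `HexSAWSurfaceAdsorptionExcess.lean` (uses `inv_le_stripNu_of_stripYT_lt`, the far end of its convexity chord).
-/

noncomputable section

open Finset Filter Topology Literature.Probability.LatticeModels Literature.Probability.Percolation SimpleGraph

namespace Literature.Probability.RandomPlanarGeometry.SAW.HV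


/-! ### (b) Bridges of `S_{T,L}` are strip chains: `ν_T(y) < x_c⁻¹ ⇒ y ≤ y_T` -/

/-- The strip chains of different lengths are disjoint. [cite: MadrasSlade1993, §8.2, eq. (8.2.1) (p. 267: the walks of a tube up to its translations)] -/
theorem disjoint_stripChains (T : ℕ) {n n' : ℕ} (h : n ≠ n') : Disjoint (stripChains T n) (stripChains T n') := by
  rw [Finset.disjoint_left]
  intro l hl hl'
  exact h (by have := (mem_stripChains_iff.1 hl).2.2.1; have := (mem_stripChains_iff.1 hl').2.2.1; omega)

/-- A bridge of `S_{T,L}` (inner list of a walk `a → β`) is a strip chain of `S_T` with `|l| - 1` steps, and `|l| ≤ |V(S_{T,L})|`.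
[cite: DuminilCopinSmirnov2012, §3 (bridges of S_{T,L})] -/
theorem mem_stripChains_of_mem_bridgeLists {T L : ℕ} (hT : 1 ≤ T) {l : List HV} (hl : l ∈ bridgeLists T L) :
    l ∈ stripChains T (l.length - 1) ∧ l.length ≤ (stripV T L).card := by
  obtain ⟨hc, hh, hnd, hV, hne, -⟩ := (mem_bridgeLists_iff hT).1 hl
  have hpos : 0 < l.length := List.length_pos_iff.2 hne
  refine ⟨mem_stripChains_iff.2 ⟨hc, hnd, by omega, ⟨hvOrigin, hh, rfl⟩, fun v hv => lev_mem_of_mem_stripV (hV v hv)⟩, ?_⟩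
  rw [← List.toFinset_card_of_nodup hnd]
  exact card_le_card fun v hv => hV v (List.mem_toFinset.1 hv)

/-- **`B_{T,L}(x_c; y) ≤ Σ_{n < |V(S_{T,L})|} x_c^{n+1} Z_n(y)`** (`y ≥ 0`): every bridge is a strip chain.
[cite: BeatonBousquetMelouDeGierDuminilCopinGuttmann2014, Corollary 8 (arXiv v5 p. 12: "the series C_T(x_c, y) converges if x_c < ρ_T(y)"); lane: bridges ⊆ all walks] -/
theorem stripGFy_beta_le_sum_stripZL {T : ℕ} (hT : 1 ≤ T) (L : ℕ) {y : ℝ} (hy : 0 ≤ y) :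
    stripGFy T L (IsBetaDart T) y ≤
      ∑ n ∈ range ((stripV T L).card), hexCriticalFugacity ^ (n + 1) * stripZL T n y := by
  have hx := hexCriticalFugacity_pos_lt_one.1
  rw [stripGFy_beta_eq_sum_bridgeLists hT]
  have hsub : bridgeLists T L ⊆ (range ((stripV T L).card)).biUnion (stripChains T) := by
    intro l hl
    obtain ⟨h1, h2⟩ := mem_stripChains_of_mem_bridgeLists hT hl
    have hpos : 0 < l.length := List.length_pos_iff.2 ((mem_bridgeLists_iff hT).1 hl).2.2.2.2.1
    exact mem_biUnion.2 ⟨l.length - 1, mem_range.2 (by omega), h1⟩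
  calc ∑ l ∈ bridgeLists T L, hexCriticalFugacity ^ l.length * y ^ (l.filter fun v => lev v = 2 * (T : ℤ) - 1).length
      ≤ ∑ l ∈ (range ((stripV T L).card)).biUnion (stripChains T),
          hexCriticalFugacity ^ l.length * y ^ (l.filter fun v => lev v = 2 * (T : ℤ) - 1).length :=
        sum_le_sum_of_subset_of_nonneg hsub fun _ _ _ => by positivity
    _ = ∑ n ∈ range ((stripV T L).card), ∑ l ∈ stripChains T n,
          hexCriticalFugacity ^ l.length * y ^ (l.filter fun v => lev v = 2 * (T : ℤ) - 1).length :=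
        sum_biUnion fun n _ n' _ hnn => disjoint_stripChains T hnn
    _ = ∑ n ∈ range ((stripV T L).card), hexCriticalFugacity ^ (n + 1) * stripZL T n y := by
        refine sum_congr rfl fun n _ => ?_
        rw [stripZL, mul_sum]
        refine sum_congr rfl fun l hl => ?_
        rw [(mem_stripChains_iff.1 hl).2.2.1]; rfl

/-- **Summability below `x_c⁻¹`**: if `ν_T(y) < x_c⁻¹` then `Σ_n x_c^{n+1} Z_n(y) < ∞` (`Z_n^{1/n} → ν_T`).
[cite: BeatonBousquetMelouDeGierDuminilCopinGuttmann2014, Corollary 8 (arXiv v5 p. 12: "By definition of ρ_T, the series C_T(x_c, y) converges if x_c < ρ_T(y)")] -/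
theorem summable_pow_mul_stripZL {T : ℕ} (hT : 1 ≤ T) {y : ℝ} (hy : 0 < y) (hν : stripNu T y < hexCriticalFugacity⁻¹) :
    Summable (fun n : ℕ => hexCriticalFugacity ^ (n + 1) * stripZL T n y) := by
  have hx := hexCriticalFugacity_pos_lt_one.1
  set ρ := (stripNu T y + hexCriticalFugacity⁻¹) / 2 with hρ
  have hνρ : stripNu T y < ρ := by rw [hρ]; linarith
  have hρx : ρ * hexCriticalFugacity < 1 := by
    have : ρ < hexCriticalFugacity⁻¹ := by rw [hρ]; linarith
    calc ρ * hexCriticalFugacity < hexCriticalFugacity⁻¹ * hexCriticalFugacity := mul_lt_mul_of_pos_right this hx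
      _ = 1 := inv_mul_cancel₀ hx.ne'
  have hρ0 : 0 < ρ := by have := stripNu_pos hT hy; rw [hρ]; positivity
  have hev : ∀ᶠ n : ℕ in atTop, hexCriticalFugacity ^ (n + 1) * stripZL T n y ≤ hexCriticalFugacity * (ρ * hexCriticalFugacity) ^ n := by
    have h1 := (tendsto_stripZL_rpow hT hy).eventually (gt_mem_nhds hνρ)
    filter_upwards [h1, eventually_ge_atTop 1] with n hn hn1
    have hZ0 : 0 ≤ stripZL T n y := stripZL_nonneg T n hy.le
    have hpow : stripZL T n y ≤ ρ ^ n := by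
      have h2 : ((stripZL T n y) ^ (1 / (n : ℝ))) ^ (n : ℝ) ≤ ρ ^ (n : ℝ) :=
        Real.rpow_le_rpow (Real.rpow_nonneg hZ0 _) hn.le (Nat.cast_nonneg n)
      rw [← Real.rpow_mul hZ0, one_div_mul_cancel (by positivity), Real.rpow_one, Real.rpow_natCast] at h2
      exact h2
    calc hexCriticalFugacity ^ (n + 1) * stripZL T n y = hexCriticalFugacity * (hexCriticalFugacity ^ n * stripZL T n y) := by ring
      _ ≤ hexCriticalFugacity * (hexCriticalFugacity ^ n * ρ ^ n) :=
          mul_le_mul_of_nonneg_left (mul_le_mul_of_nonneg_left hpow (pow_nonneg hx.le n)) hx.le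
      _ = hexCriticalFugacity * (ρ * hexCriticalFugacity) ^ n := by rw [mul_pow]; ring
  refine Summable.of_norm_bounded_eventually_nat
    ((summable_geometric_of_lt_one (by positivity) hρx).mul_left hexCriticalFugacity) ?_
  filter_upwards [hev] with n hn
  rw [Real.norm_of_nonneg (mul_nonneg (pow_nonneg hx.le _) (stripZL_nonneg T n hy.le))]
  exact hn

/-- **`ν_T(y) < x_c⁻¹ ⇒ y ∈ stripBddSet T`** (the bridge class stays bounded in `L`: it is dominated by the convergent series
`Σ x_c^{n+1} Z_n(y)`). [cite: BeatonBousquetMelouDeGierDuminilCopinGuttmann2014, Corollary 8 (arXiv v5 p. 12); GlazmanManolescu2019, Proposition 1.2 (arXiv v3 p. 6)] -/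
theorem mem_stripBddSet_of_stripNu_lt {T : ℕ} (hT : 1 ≤ T) {y : ℝ} (hy : 0 < y) (hν : stripNu T y < hexCriticalFugacity⁻¹) :
    y ∈ stripBddSet T := by
  have hs := summable_pow_mul_stripZL hT hy hν
  have hx := hexCriticalFugacity_pos_lt_one.1
  refine ⟨hy.le, ⟨∑' n, hexCriticalFugacity ^ (n + 1) * stripZL T n y, ?_⟩⟩
  rintro _ ⟨L, rfl⟩
  exact (stripGFy_beta_le_sum_stripZL hT L hy.le).trans
    (hs.sum_le_tsum _ fun n _ => mul_nonneg (pow_nonneg hx.le _) (stripZL_nonneg T n hy.le))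

/-- **Above the threshold the growth rate is at least `μ_ℍ = x_c⁻¹`**: `y_T < y ⇒ x_c⁻¹ ≤ ν_T(y)`.
[cite: BeatonBousquetMelouDeGierDuminilCopinGuttmann2014, Corollary 8 (arXiv v5 p. 12: "ρ_T(y) < ρ_T(y_T) ⟺ y > y_T"); lane: weak form for the lane's y_T] -/
theorem inv_le_stripNu_of_stripYT_lt {T : ℕ} (hT : 1 ≤ T) {y : ℝ} (hy : 0 < y) (h : stripYT T < y) :
    hexCriticalFugacity⁻¹ ≤ stripNu T y := by
  by_contra hlt
  push Not at hlt
  have hmem := mem_stripBddSet_of_stripNu_lt hT hy hlt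
  exact absurd (le_stripYT hT hy.le hmem.2) (not_le.2 h)

/-! ### (a) Below the threshold: the finite Hammersley–Welsh-type decomposition inside the strip -/

section Below

variable {T : ℕ}

/-- The weight `x_c^{#steps} y^{topCnt}` of a vertex list. [cite: BeatonBousquetMelouDeGierDuminilCopinGuttmann2014, §3.2 (arXiv v5 p. 12: C_T(x,y) := Σ_n C_{T,n}(1,y) xⁿ)] -/
def wgt (T : ℕ) (y : ℝ) (l : List HV) : ℝ := hexCriticalFugacity ^ (l.length - 1) * y ^ topCnt T l

/-- `wgt ≥ 0` for `y ≥ 0`. [cite: BeatonBousquetMelouDeGierDuminilCopinGuttmann2014, Proposition 6 (arXiv v5 p. 10)] -/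
theorem wgt_nonneg (T : ℕ) {y : ℝ} (hy : 0 ≤ y) (l : List HV) : 0 ≤ wgt T y l :=
  mul_nonneg (pow_nonneg hexCriticalFugacity_pos_lt_one.1.le _) (pow_nonneg hy _)

/-- The strip chains with at most `N` steps. [cite: MadrasSlade1993, §8.2, eq. (8.2.1)] -/
def allTo (T N : ℕ) : Finset (List HV) := (range (N + 1)).biUnion (stripChains T)

/-- Membership in `allTo`. [cite: MadrasSlade1993, §8.2, eq. (8.2.1) (p. 267: the walks of a tube up to its translations)] -/
theorem mem_allTo_iff {N : ℕ} {l : List HV} :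
    l ∈ allTo T N ↔ l.IsChain hvGraph.Adj ∧ l.Nodup ∧ l ≠ [] ∧ l.length ≤ N + 1 ∧
      (∃ v, l.head? = some v ∧ v.1 = 0) ∧ InLev T l := by
  rw [allTo, mem_biUnion]
  constructor
  · rintro ⟨n, hn, hl⟩
    obtain ⟨hc, hnd, hlen, hh, hin⟩ := mem_stripChains_iff.1 hl
    exact ⟨hc, hnd, ne_nil_of_mem_stripChains hl, by rw [mem_range] at hn; omega, hh, hin⟩
  · rintro ⟨hc, hnd, hne, hlen, hh, hin⟩
    have hpos := List.length_pos_iff.2 hne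
    exact ⟨l.length - 1, mem_range.2 (by omega), mem_stripChains_iff.2 ⟨hc, hnd, by omega, hh, hin⟩⟩

/-- "Bottomed" lists: no vertex lies below the head. [cite: DuminilCopinSmirnov2012, §3 (half-plane walks: the start has minimal level)] -/
def IsUp (l : List HV) : Prop := ∀ v ∈ l, lev (l.headD hvOrigin) ≤ lev v

/-- Decidability of `IsUp`. [folklore] -/
instance (l : List HV) : Decidable (IsUp l) := by unfold IsUp; infer_instance

/-- The bottomed strip chains with at most `N` steps. [cite: DuminilCopinSmirnov2012, §3] -/
def upTo (T N : ℕ) : Finset (List HV) := (allTo T N).filter IsUp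

/-- The test "the last vertex lies on the top level `2T − 1`". [cite: DuminilCopinSmirnov2012, §3 (bridges)] -/
def EndsTop (T : ℕ) (l : List HV) : Prop := ∃ v, l.getLast? = some v ∧ lev v = 2 * (T : ℤ) - 1

/-- Decidability of `EndsTop`. [folklore] -/
instance (T : ℕ) (l : List HV) : Decidable (EndsTop T l) := by unfold EndsTop; infer_instance

/-- The weak bridges to the top: bottomed strip chains ending on the top level. [cite: DuminilCopinSmirnov2012, §3 (bridges of S_T)] -/
def wbTo (T N : ℕ) : Finset (List HV) := (upTo T N).filter (EndsTop T)

/-! #### The sub-criticality constant for unweighted chains -/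

/-- `G₀(T) := Σ_k c_k(S_{T−1}) x_c^k < ∞` (sub-criticality of the brick-wall strip carrying `S_T`). [cite: BeatonBousquetMelouDeGierDuminilCopinGuttmann2014, Corollary 8 at y = 1 (arXiv v5 p. 12: ρ_T(1) > x_c); lane: `HV.summable_stripCount_mul_pow`] -/
def G0 (T : ℕ) : ℝ := ∑' k, (HexBW.stripCount (T - 1) k : ℝ) * hexCriticalFugacity ^ k

/-- `card (stdHeads T) ≤ 2T`. [cite: MadrasSlade1993, §8.2, eq. (8.2.1) (p. 267: the walks of a tube up to its translations)] -/
theorem card_stdHeads_le (T : ℕ) : (stdHeads T).card ≤ 2 * T := by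
  refine (card_image_le).trans ?_
  rw [card_product, card_range, card_univ, Fintype.card_bool]; omega

/-- **`|stripChains T n| ≤ 2T · c_n(S_{T−1})`** (per standard head, `HV.toPair` injects into the brick-wall strip pairs).
[cite: MadrasSlade1993, §8.2, eq. (8.2.1)] -/
theorem card_stripChains_le (hT : 1 ≤ T) (n : ℕ) : (stripChains T n).card ≤ 2 * T * HexBW.stripCount (T - 1) n := by
  classical
  have h1 : (stripChains T n).card ≤ ∑ v ∈ stdHeads T, ((sawFin v n).filter (InLev T)).card := by
    rw [stripChains, filter_biUnion]
    exact card_biUnion_le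
  have h2 : ∀ v ∈ stdHeads T, ((sawFin v n).filter (InLev T)).card ≤ HexBW.stripCount (T - 1) n := by
    intro v _
    rw [HexBW.stripCount]
    refine card_le_card_of_injOn toPair (fun l hl => ?_) fun l hl l' hl' h => ?_
    · rw [mem_coe, mem_filter, mem_sawFin_iff, mem_sawLists_iff] at hl
      obtain ⟨⟨hc, hh, hlen, hnd⟩, hin⟩ := hl
      have hne : l ≠ [] := by rintro rfl; simp at hlen
      have := toPair_mem hT hne hc hnd hin
      rwa [hlen, Nat.add_sub_cancel] at this
    · rw [mem_coe, mem_filter, mem_sawFin_iff, mem_sawLists_iff] at hl hl'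
      exact toPair_inj (by rintro rfl; simp at hl) (by rintro rfl; simp at hl') (hl.1.2.1.trans hl'.1.2.1.symm)
        (hl.1.2.2.1.trans hl'.1.2.2.1.symm) h
  calc (stripChains T n).card ≤ ∑ v ∈ stdHeads T, ((sawFin v n).filter (InLev T)).card := h1
    _ ≤ ∑ _v ∈ stdHeads T, HexBW.stripCount (T - 1) n := sum_le_sum h2
    _ = (stdHeads T).card * HexBW.stripCount (T - 1) n := by rw [sum_const, smul_eq_mul]
    _ ≤ 2 * T * HexBW.stripCount (T - 1) n := Nat.mul_le_mul_right _ (card_stdHeads_le T)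

/-- **The unweighted chains are summable at `x_c`**: `Σ_{c ∈ allTo T N} x_c^{#steps(c)} ≤ 2T · G₀(T)` for every `N`.
[cite: BeatonBousquetMelouDeGierDuminilCopinGuttmann2014, proof of Proposition 9 (arXiv v5 p. 14: "the generating function of walks in the T-strip converges"); lane: strip sub-criticality] -/
theorem sum_allTo_pow_le (hT : 1 ≤ T) (N : ℕ) :
    ∑ c ∈ allTo T N, hexCriticalFugacity ^ (c.length - 1) ≤ 2 * T * G0 T := by
  have hx := hexCriticalFugacity_pos_lt_one.1
  have hsum := summable_stripCount_mul_pow (T - 1)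
  rw [allTo, sum_biUnion fun n _ n' _ hnn => disjoint_stripChains T hnn]
  have h1 : ∀ n ∈ range (N + 1), ∑ c ∈ stripChains T n, hexCriticalFugacity ^ (c.length - 1) ≤
      2 * T * ((HexBW.stripCount (T - 1) n : ℝ) * hexCriticalFugacity ^ n) := by
    intro n _
    have e : ∀ c ∈ stripChains T n, hexCriticalFugacity ^ (c.length - 1) = hexCriticalFugacity ^ n := by
      intro c hc; rw [(mem_stripChains_iff.1 hc).2.2.1, Nat.add_sub_cancel]
    rw [sum_congr rfl e, sum_const, nsmul_eq_mul]
    have := card_stripChains_le hT n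
    calc ((stripChains T n).card : ℝ) * hexCriticalFugacity ^ n ≤ (2 * T * HexBW.stripCount (T - 1) n : ℕ) * hexCriticalFugacity ^ n :=
          mul_le_mul_of_nonneg_right (by exact_mod_cast this) (pow_nonneg hx.le n)
      _ = 2 * T * ((HexBW.stripCount (T - 1) n : ℝ) * hexCriticalFugacity ^ n) := by push_cast; ring
  calc ∑ n ∈ range (N + 1), ∑ c ∈ stripChains T n, hexCriticalFugacity ^ (c.length - 1)
      ≤ ∑ n ∈ range (N + 1), 2 * T * ((HexBW.stripCount (T - 1) n : ℝ) * hexCriticalFugacity ^ n) := sum_le_sum h1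
    _ = 2 * T * ∑ n ∈ range (N + 1), (HexBW.stripCount (T - 1) n : ℝ) * hexCriticalFugacity ^ n := by rw [mul_sum]
    _ ≤ 2 * T * G0 T := by
        refine mul_le_mul_of_nonneg_left ?_ (by positivity)
        exact hsum.sum_le_tsum _ fun n _ => by positivity

/-- `G₀(T) ≥ 0`. [cite: BeatonBousquetMelouDeGierDuminilCopinGuttmann2014, Proposition 6 (arXiv v5 p. 10)] -/
theorem G0_nonneg (T : ℕ) : 0 ≤ G0 T :=
  tsum_nonneg fun _ => mul_nonneg (Nat.cast_nonneg _) (pow_nonneg hexCriticalFugacity_pos_lt_one.1.le _)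

end Below


section HW

variable {T N : ℕ}

/-! #### Pure list facts -/

/-- Splitting the top count at a vertex: the vertex `l[m]` is counted on both sides. [cite: BeatonBousquetMelouDeGierDuminilCopinGuttmann2014, §3.2 (arXiv v5 p. 10: c_{T,k}(y,z) = Σ y^{bc(ω)} z^{tc(ω)}, tc(ω) = contacts with the top of the strip)] -/
theorem topCnt_take_add_drop (T : ℕ) {l : List HV} {m : ℕ} (hm : m < l.length) :
    topCnt T (l.take (m + 1)) + topCnt T (l.drop m) = topCnt T l + if lev l[m] = 2 * (T : ℤ) - 1 then 1 else 0 := by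
  have e1 : l.take (m + 1) = l.take m ++ [l[m]] := by rw [List.take_add_one, List.getElem?_eq_getElem hm]; rfl
  have e2 : l.drop m = l[m] :: l.drop (m + 1) := List.drop_eq_getElem_cons hm
  have e3 : topCnt T l = topCnt T (l.take m) + topCnt T (l.drop m) := by rw [← topCnt_append, List.take_append_drop]
  rw [e1, topCnt_append, topCnt_singleton, e3, e2, topCnt_cons]
  omega

/-- A list all of whose vertices avoid the top level has `topCnt = 0`. [cite: BeatonBousquetMelouDeGierDuminilCopinGuttmann2014, §3.2 (arXiv v5 p. 10: c_{T,k}(y,z) = Σ y^{bc(ω)} z^{tc(ω)}, tc(ω) = contacts with the top of the strip)] -/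
theorem topCnt_eq_zero_of_forall (T : ℕ) {l : List HV} (h : ∀ v ∈ l, lev v ≠ 2 * (T : ℤ) - 1) : topCnt T l = 0 := by
  rw [topCnt, List.length_eq_zero_iff, List.filter_eq_nil_iff]
  intro v hv; simpa using h v hv

/-- `IsUp` is invariant under `xstd`. [cite: DuminilCopinSmirnov2012, §3 (cutting a self-avoiding walk at its last vertex of extremal level)] -/
theorem isUp_xstd {l : List HV} (h : IsUp l) : IsUp (xstd l) := by
  cases l with
  | nil => intro v hv; simp [xstd] at hv
  | cons a t =>
    intro v hv
    simp only [xstd, List.headD_cons, List.map_cons, List.mem_cons, List.mem_map] at hv ⊢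
    rw [lev_shift_zero]
    rcases hv with rfl | ⟨w, hw, rfl⟩
    · rw [lev_shift_zero]
    · rw [lev_shift_zero]; exact h w (by simp [hw])

/-- The head of a nonempty `take`. [cite: DuminilCopinSmirnov2012, §3 (cutting a self-avoiding walk at its last vertex of extremal level)] -/
theorem headD_take_succ (l : List HV) (k : ℕ) : (l.take (k + 1)).headD hvOrigin = l.headD hvOrigin := by
  cases l <;> simp

/-! #### The split at the last lowest vertex -/

/-- First piece: the prefix up to the last lowest vertex, reversed and standardised (a bottomed chain).
[cite: DuminilCopinSmirnov2012, §3 ("one can cut the trajectory into two pieces")] -/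
def lowFst (l : List HV) : List HV := xstd (l.take (lastArgmin l + 1)).reverse

/-- Second piece: the suffix from the last lowest vertex, standardised. [cite: DuminilCopinSmirnov2012, §3] -/
def lowSnd (l : List HV) : List HV := xstd (l.drop (lastArgmin l))

/-- Anatomy of a member of `allTo`. [cite: DuminilCopinSmirnov2012, §3 (cutting a self-avoiding walk at its last vertex of extremal level)] -/
theorem allTo_anatomy {ω : List HV} (hc : ω ∈ allTo T N) :
    ∃ hm : lastArgmin ω < ω.length,
      (∀ (j : ℕ) (hj : j < ω.length), lev ω[lastArgmin ω] ≤ lev ω[j]) ∧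
      (ω.take (lastArgmin ω + 1)).reverse.headD hvOrigin = ω[lastArgmin ω] ∧
      (ω.drop (lastArgmin ω)).headD hvOrigin = ω[lastArgmin ω] ∧
      ∃ v, ω.head? = some v ∧ v.1 = 0 ∧ (ω.take (lastArgmin ω + 1)).reverse.getLast? = some v := by
  obtain ⟨hch, hnd, hne, hlen, ⟨v, hh, hv⟩, hin⟩ := mem_allTo_iff.1 hc
  obtain ⟨hm, hmin, -⟩ := lastArgmin_spec hne
  refine ⟨hm, hmin, ?_, ?_, v, hh, hv, ?_⟩
  · rw [List.headD_eq_head?_getD, List.head?_reverse, List.getLast?_take, if_neg (by omega), Nat.add_sub_cancel,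
      List.getElem?_eq_getElem hm, Option.some_or]
    rfl
  · rw [List.headD_eq_head?_getD, List.head?_drop, List.getElem?_eq_getElem hm]; rfl
  · rw [List.getLast?_reverse, List.head?_take, if_neg (by omega), hh]

/-- The first piece is a bottomed strip chain of at most `N` steps. [cite: DuminilCopinSmirnov2012, §3] -/
theorem lowFst_mem {ω : List HV} (hc : ω ∈ allTo T N) : lowFst ω ∈ upTo T N := by
  obtain ⟨hch, hnd, hne, hlen, -, hin⟩ := mem_allTo_iff.1 hc
  obtain ⟨hm, hmin, hhd, -, v, hh, hv, hlast⟩ := allTo_anatomy hc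
  set L := (ω.take (lastArgmin ω + 1)).reverse with hL
  have hLne : L ≠ [] := by simp [hL, hne]
  have hLmem : ∀ w ∈ L, ∃ (j : ℕ) (hj : j < ω.length), ω[j] = w := fun w hw =>
    List.getElem_of_mem (List.mem_of_mem_take (List.mem_reverse.1 hw))
  rw [upTo, mem_filter, lowFst, ← hL]
  refine ⟨mem_allTo_iff.2 ⟨?_, ?_, by simpa [xstd] using hLne, ?_, ?_, ?_⟩, isUp_xstd fun w hw => ?_⟩
  · refine isChain_xstd ?_
    rw [hL, List.isChain_reverse]
    exact (hch.take _).imp fun x y (h : hvGraph.Adj x y) => h.symm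
  · exact nodup_xstd (List.nodup_reverse.2 (hnd.sublist (List.take_sublist _ _)))
  · simp only [length_xstd, hL, List.length_reverse, List.length_take]; omega
  · refine ⟨(0, (ω[lastArgmin ω]).2.1, (ω[lastArgmin ω]).2.2), head?_xstd ?_, rfl⟩
    obtain ⟨a, t, hat⟩ := List.exists_cons_of_ne_nil hLne
    rw [hat, List.headD_cons] at hhd
    rw [hat, List.head?_cons, hhd]
  · exact inLev_xstd fun w hw => by obtain ⟨j, hj, rfl⟩ := hLmem w hw; exact hin _ (List.getElem_mem hj)
  · rw [hhd]
    obtain ⟨j, hj, rfl⟩ := hLmem w hw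
    exact hmin j hj

/-- The second piece is a bottomed strip chain of at most `N` steps. [cite: DuminilCopinSmirnov2012, §3] -/
theorem lowSnd_mem {ω : List HV} (hc : ω ∈ allTo T N) : lowSnd ω ∈ upTo T N := by
  obtain ⟨hch, hnd, hne, hlen, -, hin⟩ := mem_allTo_iff.1 hc
  obtain ⟨hm, hmin, -, hhd, -⟩ := allTo_anatomy hc
  rw [upTo, mem_filter, lowSnd]
  refine ⟨mem_allTo_iff.2 ⟨isChain_xstd (hch.drop _), nodup_xstd (hnd.sublist (List.drop_sublist _ _)), ?_, ?_, ?_, ?_⟩,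
    isUp_xstd fun w hw => ?_⟩
  · simp [xstd, List.drop_eq_nil_iff]; omega
  · simp only [length_xstd, List.length_drop]; omega
  · exact ⟨(0, (ω[lastArgmin ω]).2.1, (ω[lastArgmin ω]).2.2),
      head?_xstd (by rw [List.head?_drop, List.getElem?_eq_getElem hm]), rfl⟩
  · exact inLev_xstd fun w hw => hin w (List.mem_of_mem_drop hw)
  · rw [hhd]
    obtain ⟨j, hj, rfl⟩ := List.getElem_of_mem hw
    simp only [List.getElem_drop]
    exact hmin _ _

/-- The weight splits (the shared lowest vertex may be a top vertex only in degenerate cases; `max(1,y⁻¹)` absorbs it).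
[cite: MadrasSlade1993, §3.1, (3.1.11) (the two half-space walks)] -/
theorem wgt_le_lowFst_lowSnd {ω : List HV} (hc : ω ∈ allTo T N) {y : ℝ} (hy : 0 < y) :
    wgt T y ω ≤ HexBW.yK y * (wgt T y (lowFst ω) * wgt T y (lowSnd ω)) := by
  obtain ⟨-, -, hne, -, -, -⟩ := mem_allTo_iff.1 hc
  obtain ⟨hm, -⟩ := allTo_anatomy hc
  have hx := hexCriticalFugacity_pos_lt_one.1
  have hK := HexBW.one_le_yK y
  have hl1 : (lowFst ω).length = lastArgmin ω + 1 := by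
    simp only [lowFst, length_xstd, List.length_reverse, List.length_take]; omega
  have hl2 : (lowSnd ω).length = ω.length - lastArgmin ω := by simp only [lowSnd, length_xstd, List.length_drop]
  have hc1 : topCnt T (lowFst ω) = topCnt T (ω.take (lastArgmin ω + 1)) := by rw [lowFst, topCnt_xstd, topCnt_reverse]
  have hc2 : topCnt T (lowSnd ω) = topCnt T (ω.drop (lastArgmin ω)) := by rw [lowSnd, topCnt_xstd]
  have hsplit := topCnt_take_add_drop T hm
  have hxpow : hexCriticalFugacity ^ (ω.length - 1) =
      hexCriticalFugacity ^ ((lowFst ω).length - 1) * hexCriticalFugacity ^ ((lowSnd ω).length - 1) := by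
    rw [hl1, hl2, ← pow_add]; congr 1; omega
  have hypow : y ^ topCnt T ω ≤ HexBW.yK y * (y ^ topCnt T (lowFst ω) * y ^ topCnt T (lowSnd ω)) := by
    rw [hc1, hc2, ← pow_add, hsplit, pow_add]
    split_ifs
    · rw [pow_one]
      calc y ^ topCnt T ω = y⁻¹ * (y ^ topCnt T ω * y) := by field_simp
        _ ≤ HexBW.yK y * (y ^ topCnt T ω * y) := mul_le_mul_of_nonneg_right (HexBW.inv_le_yK y) (by positivity)
    · rw [pow_zero, mul_one]; exact le_mul_of_one_le_left (by positivity) hK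
  unfold wgt
  rw [hxpow]
  calc hexCriticalFugacity ^ ((lowFst ω).length - 1) * hexCriticalFugacity ^ ((lowSnd ω).length - 1) * y ^ topCnt T ω
      ≤ hexCriticalFugacity ^ ((lowFst ω).length - 1) * hexCriticalFugacity ^ ((lowSnd ω).length - 1) *
          (HexBW.yK y * (y ^ topCnt T (lowFst ω) * y ^ topCnt T (lowSnd ω))) :=
        mul_le_mul_of_nonneg_left hypow (by positivity)
    _ = _ := by ring

/-- The gluing map inverting the split. [cite: DuminilCopinSmirnov2012, §3 (cutting a self-avoiding walk at its last vertex of extremal level)] -/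
def lowGlue (r s : List HV) : List HV :=
  (r.map (shift (-(r.getLast?.getD hvOrigin).1) 0)).reverse ++ (s.map (shift (-(r.getLast?.getD hvOrigin).1) 0)).tail

/-- The split is inverted by `lowGlue` on `allTo`. [cite: DuminilCopinSmirnov2012, §3 ("the decomposition uniquely determines the walk")] -/
theorem lowGlue_lowFst_lowSnd {ω : List HV} (hc : ω ∈ allTo T N) : lowGlue (lowFst ω) (lowSnd ω) = ω := by
  obtain ⟨hm, -, hhd, hhd2, v, hh, hv, hlast⟩ := allTo_anatomy hc
  have ha : -((lowFst ω).getLast?.getD hvOrigin).1 = (ω[lastArgmin ω]).1 := by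
    rw [lowFst, xstd, List.getLast?_map, hlast, Option.map_some, Option.getD_some, hhd, shift_apply, hv]; ring
  have e1 : (lowFst ω).map (shift (ω[lastArgmin ω]).1 0) = (ω.take (lastArgmin ω + 1)).reverse := by
    rw [lowFst, ← hhd]; exact map_shift_xstd _
  have e2 : (lowSnd ω).map (shift (ω[lastArgmin ω]).1 0) = ω.drop (lastArgmin ω) := by
    rw [lowSnd, ← hhd2]; exact map_shift_xstd _
  rw [lowGlue, ha, e1, e2, List.reverse_reverse, List.tail_drop, List.take_append_drop]

/-- The split is injective on `allTo T N`. [cite: DuminilCopinSmirnov2012, §3] -/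
theorem low_injOn : Set.InjOn (fun c => (lowFst c, lowSnd c)) (allTo T N : Set (List HV)) := by
  intro c hc c' hc' h
  simp only [Prod.mk.injEq] at h
  rw [← lowGlue_lowFst_lowSnd (mem_coe.1 hc), ← lowGlue_lowFst_lowSnd (mem_coe.1 hc'), h.1, h.2]

/-- **Step 1**: `Σ_{c ∈ allTo} wgt c ≤ max(1,y⁻¹) (Σ_{p ∈ upTo} wgt p)²`. [cite: MadrasSlade1993, §3.1, (3.1.11)–(3.1.12) (p. 60); DuminilCopinSmirnov2012, §3] -/
theorem sum_allTo_wgt_le (T N : ℕ) {y : ℝ} (hy : 0 < y) :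
    ∑ c ∈ allTo T N, wgt T y c ≤ HexBW.yK y * (∑ p ∈ upTo T N, wgt T y p) ^ 2 := by
  have hK := HexBW.one_le_yK y
  calc ∑ c ∈ allTo T N, wgt T y c
      ≤ ∑ c ∈ allTo T N, HexBW.yK y * (wgt T y (lowFst c) * wgt T y (lowSnd c)) :=
        sum_le_sum fun c hc => wgt_le_lowFst_lowSnd hc hy
    _ = HexBW.yK y * ∑ c ∈ allTo T N, wgt T y (lowFst c) * wgt T y (lowSnd c) := by rw [mul_sum]
    _ ≤ HexBW.yK y * ∑ q ∈ upTo T N ×ˢ upTo T N, wgt T y q.1 * wgt T y q.2 := by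
        refine mul_le_mul_of_nonneg_left ?_ (by linarith)
        exact sum_le_sum_of_injOn_of_nonneg (fun c => (lowFst c, lowSnd c)) low_injOn
          (fun c hc => mem_product.2 ⟨lowFst_mem hc, lowSnd_mem hc⟩) (fun q => wgt T y q.1 * wgt T y q.2)
          fun _ _ => mul_nonneg (wgt_nonneg T hy.le _) (wgt_nonneg T hy.le _)
    _ = HexBW.yK y * (∑ p ∈ upTo T N, wgt T y p) ^ 2 := by rw [sum_product, sq, sum_mul_sum]

/-! #### Extracting the weak bridge of a bottomed chain that touches the top -/

/-- The weak bridge: the prefix up to the last top vertex. [cite: DuminilCopinSmirnov2012, §3 ("The n first vertices of the walk form a bridge")] -/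
def topBr (l : List HV) : List HV := l.take (lastArgmax l + 1)

/-- The remainder after the last top vertex, standardised. [cite: DuminilCopinSmirnov2012, §3] -/
def topRest (l : List HV) : List HV := xstd (l.drop (lastArgmax l))

/-- Anatomy of a bottomed chain with a top vertex: the last highest vertex is on the top level, later vertices strictly below.
[cite: DuminilCopinSmirnov2012, §3 (cutting a self-avoiding walk at its last vertex of extremal level)] -/
theorem upTo_top_anatomy {p : List HV} (hp : p ∈ upTo T N) (hcnt : topCnt T p ≠ 0) :
    ∃ hk : lastArgmax p < p.length,
      lev p[lastArgmax p] = 2 * (T : ℤ) - 1 ∧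
      (∀ (j : ℕ) (hj : j < p.length), lastArgmax p < j → lev p[j] < 2 * (T : ℤ) - 1) ∧
      (p.drop (lastArgmax p)).headD hvOrigin = p[lastArgmax p] ∧
      (p.take (lastArgmax p + 1)).getLast? = some p[lastArgmax p] := by
  rw [upTo, mem_filter] at hp
  obtain ⟨hch, hnd, hne, hlen, -, hin⟩ := mem_allTo_iff.1 hp.1
  obtain ⟨hk, hmax, hstrict⟩ := lastArgmax_spec hne
  have htop : lev p[lastArgmax p] = 2 * (T : ℤ) - 1 := by
    obtain ⟨w, hw⟩ := List.length_pos_iff_exists_mem.1 (Nat.pos_of_ne_zero hcnt)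
    rw [List.mem_filter] at hw
    obtain ⟨j, hj, rfl⟩ := List.getElem_of_mem hw.1
    have h1 := hmax j hj
    have h2 := (hin _ (List.getElem_mem hk)).2
    have h3 : lev p[j] = 2 * (T : ℤ) - 1 := by simpa using hw.2
    omega
  refine ⟨hk, htop, fun j hj hlt => htop ▸ hstrict j hj hlt, ?_, ?_⟩
  · rw [List.headD_eq_head?_getD, List.head?_drop, List.getElem?_eq_getElem hk]; rfl
  · rw [List.getLast?_take, if_neg (by omega), Nat.add_sub_cancel, List.getElem?_eq_getElem hk, Option.some_or]

/-- The weak bridge of a bottomed chain touching the top is in `wbTo`. [cite: DuminilCopinSmirnov2012, §3] -/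
theorem topBr_mem {p : List HV} (hp : p ∈ upTo T N) (hcnt : topCnt T p ≠ 0) : topBr p ∈ wbTo T N := by
  have hp' := hp
  rw [upTo, mem_filter] at hp'
  obtain ⟨hch, hnd, hne, hlen, ⟨v, hh, hv⟩, hin⟩ := mem_allTo_iff.1 hp'.1
  obtain ⟨hk, htop, -, -, hlast⟩ := upTo_top_anatomy hp hcnt
  rw [wbTo, mem_filter, upTo, mem_filter, topBr]
  refine ⟨⟨mem_allTo_iff.2 ⟨hch.take _, hnd.sublist (List.take_sublist _ _), by simp [hne], by
      simp only [List.length_take]; omega, ⟨v, by rw [List.head?_take, if_neg (by omega), hh], hv⟩,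
      fun w hw => hin w (List.mem_of_mem_take hw)⟩, fun w hw => ?_⟩, ⟨p[lastArgmax p], hlast, htop⟩⟩
  rw [headD_take_succ]
  exact hp'.2 w (List.mem_of_mem_take hw)

/-- The remainder is in `allTo`. [cite: DuminilCopinSmirnov2012, §3] -/
theorem topRest_mem {p : List HV} (hp : p ∈ upTo T N) (hcnt : topCnt T p ≠ 0) : topRest p ∈ allTo T N := by
  have hp' := hp
  rw [upTo, mem_filter] at hp'
  obtain ⟨hch, hnd, hne, hlen, -, hin⟩ := mem_allTo_iff.1 hp'.1
  obtain ⟨hk, -⟩ := upTo_top_anatomy hp hcnt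
  rw [topRest]
  refine mem_allTo_iff.2 ⟨isChain_xstd (hch.drop _), nodup_xstd (hnd.sublist (List.drop_sublist _ _)), ?_, ?_, ?_, ?_⟩
  · simp [xstd, List.drop_eq_nil_iff]; omega
  · simp only [length_xstd, List.length_drop]; omega
  · exact ⟨(0, (p[lastArgmax p]).2.1, (p[lastArgmax p]).2.2),
      head?_xstd (by rw [List.head?_drop, List.getElem?_eq_getElem hk]), rfl⟩
  · exact inLev_xstd fun w hw => hin w (List.mem_of_mem_drop hw)

/-- The weight factors: all top vertices sit in the weak bridge. [cite: DuminilCopinSmirnov2012, §3] -/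
theorem wgt_eq_topBr_topRest {p : List HV} (hp : p ∈ upTo T N) (hcnt : topCnt T p ≠ 0) {y : ℝ} :
    wgt T y p = wgt T y (topBr p) * hexCriticalFugacity ^ ((topRest p).length - 1) := by
  obtain ⟨hk, htop, hafter, -, -⟩ := upTo_top_anatomy hp hcnt
  have hl1 : (topBr p).length = lastArgmax p + 1 := by simp only [topBr, List.length_take]; omega
  have hl2 : (topRest p).length = p.length - lastArgmax p := by simp only [topRest, length_xstd, List.length_drop]
  have hsplit := topCnt_take_add_drop T hk
  have hdrop : topCnt T (p.drop (lastArgmax p)) = 1 := by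
    rw [List.drop_eq_getElem_cons hk, topCnt_cons, if_pos htop, topCnt_eq_zero_of_forall]
    intro w hw
    obtain ⟨j, hj, rfl⟩ := List.getElem_of_mem hw
    simp only [List.getElem_drop]
    exact (hafter _ _ (by omega)).ne
  rw [hdrop, if_pos htop] at hsplit
  have hc1 : topCnt T (topBr p) = topCnt T p := by rw [topBr]; omega
  unfold wgt
  rw [hc1, hl1, hl2, mul_right_comm, ← pow_add]
  congr 2; omega

/-- The gluing map inverting the bridge extraction. [cite: DuminilCopinSmirnov2012, §3 (cutting a self-avoiding walk at its last vertex of extremal level)] -/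
def topGlue (b r : List HV) : List HV := b ++ (r.map (shift (b.getLast?.getD hvOrigin).1 0)).tail

/-- The extraction is inverted by `topGlue`. [cite: DuminilCopinSmirnov2012, §3 ("the decomposition uniquely determines the walk")] -/
theorem topGlue_topBr_topRest {p : List HV} (hp : p ∈ upTo T N) (hcnt : topCnt T p ≠ 0) :
    topGlue (topBr p) (topRest p) = p := by
  obtain ⟨hk, -, -, hhd, hlast⟩ := upTo_top_anatomy hp hcnt
  rw [topGlue, topBr, hlast, Option.getD_some, topRest, ← hhd, map_shift_xstd, List.tail_drop, List.take_append_drop]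

/-- **Step 2**: `Σ_{p ∈ upTo} wgt p ≤ (Σ_{c ∈ allTo} x_c^{#steps}) · (1 + Σ_{b ∈ wbTo} wgt b)`.
[cite: DuminilCopinSmirnov2012, §3 (a half-plane walk = bridge + remainder)] -/
theorem sum_upTo_wgt_le (T N : ℕ) {y : ℝ} (hy : 0 ≤ y) :
    ∑ p ∈ upTo T N, wgt T y p ≤
      (∑ c ∈ allTo T N, hexCriticalFugacity ^ (c.length - 1)) * (1 + ∑ b ∈ wbTo T N, wgt T y b) := by
  classical
  have hx := hexCriticalFugacity_pos_lt_one.1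
  set A := ∑ c ∈ allTo T N, hexCriticalFugacity ^ (c.length - 1) with hA
  set W := ∑ b ∈ wbTo T N, wgt T y b with hW
  have hA0 : 0 ≤ A := sum_nonneg fun _ _ => pow_nonneg hx.le _
  rw [← sum_filter_add_sum_filter_not (upTo T N) (fun p => topCnt T p = 0)]
  have h0 : ∑ p ∈ (upTo T N).filter (fun p => topCnt T p = 0), wgt T y p ≤ A := by
    calc ∑ p ∈ (upTo T N).filter (fun p => topCnt T p = 0), wgt T y p
        = ∑ p ∈ (upTo T N).filter (fun p => topCnt T p = 0), hexCriticalFugacity ^ (p.length - 1) :=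
          sum_congr rfl fun p hp => by rw [wgt, (mem_filter.1 hp).2, pow_zero, mul_one]
      _ ≤ A := sum_le_sum_of_subset_of_nonneg (fun p hp => (mem_filter.1 (mem_filter.1 hp).1).1)
          fun _ _ _ => pow_nonneg hx.le _
  have h1 : ∑ p ∈ (upTo T N).filter (fun p => ¬ topCnt T p = 0), wgt T y p ≤ W * A := by
    calc ∑ p ∈ (upTo T N).filter (fun p => ¬ topCnt T p = 0), wgt T y p
        = ∑ p ∈ (upTo T N).filter (fun p => ¬ topCnt T p = 0),
            wgt T y (topBr p) * hexCriticalFugacity ^ ((topRest p).length - 1) :=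
          sum_congr rfl fun p hp => wgt_eq_topBr_topRest (mem_filter.1 hp).1 (mem_filter.1 hp).2
      _ ≤ ∑ q ∈ wbTo T N ×ˢ allTo T N, wgt T y q.1 * hexCriticalFugacity ^ (q.2.length - 1) := by
          refine sum_le_sum_of_injOn_of_nonneg (fun p => (topBr p, topRest p)) ?_
            (fun p hp => mem_product.2 ⟨topBr_mem (mem_filter.1 hp).1 (mem_filter.1 hp).2,
              topRest_mem (mem_filter.1 hp).1 (mem_filter.1 hp).2⟩)
            (fun q => wgt T y q.1 * hexCriticalFugacity ^ (q.2.length - 1))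
            fun _ _ => mul_nonneg (wgt_nonneg T hy _) (pow_nonneg hx.le _)
          intro p hp p' hp' h
          rw [mem_coe, mem_filter] at hp hp'
          simp only [Prod.mk.injEq] at h
          rw [← topGlue_topBr_topRest hp.1 hp.2, ← topGlue_topBr_topRest hp'.1 hp'.2, h.1, h.2]
      _ = W * A := by rw [sum_product, hW, hA, sum_mul_sum]
  have hW0 : 0 ≤ W := sum_nonneg fun _ _ => wgt_nonneg T hy _
  nlinarith

/-! #### The weak bridges are bridges of a lower strip: `Σ_{wbTo} wgt ≤ 2T (x_c⁻¹ + x_c⁻²) K` -/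

/-- The bridge term of `stripGFy_beta_eq_sum_bridgeLists`. [cite: BeatonBousquetMelouDeGierDuminilCopinGuttmann2014, §3.3 (B_{T,L}(x,y))] -/
def brTerm (T' : ℕ) (y : ℝ) (l : List HV) : ℝ :=
  hexCriticalFugacity ^ l.length * y ^ (l.filter fun v => lev v = 2 * (T' : ℤ) - 1).length

/-- Facts about a weak bridge with a given head `(0, j, bb)`. [cite: DuminilCopinSmirnov2012, §3 (cutting a self-avoiding walk at its last vertex of extremal level)] -/
theorem wbTo_anatomy {b : List HV} (hb : b ∈ wbTo T N) {j : ℕ} {bb : Bool} (hhead : b.headD hvOrigin = ((0 : ℤ), (j : ℤ), bb)) :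
    b.IsChain hvGraph.Adj ∧ b.Nodup ∧ b.head? = some ((0 : ℤ), (j : ℤ), bb) ∧ b.length ≤ N + 1 ∧
      (∀ w ∈ b, 2 * (j : ℤ) + bit ((0 : ℤ), (j : ℤ), bb) ≤ lev w ∧ lev w ≤ 2 * (T : ℤ) - 1 ∧ |w.1| ≤ N) ∧
      ∃ hne : b ≠ [], lev (b.getLast hne) = 2 * (T : ℤ) - 1 := by
  rw [wbTo, mem_filter, upTo, mem_filter] at hb
  obtain ⟨⟨hall, hup⟩, ⟨u, hu, hlev⟩⟩ := hb
  obtain ⟨hch, hnd, hne, hlen, ⟨v, hh, hv⟩, hin⟩ := mem_allTo_iff.1 hall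
  have hv' : v = ((0 : ℤ), (j : ℤ), bb) := by
    rw [List.headD_eq_head?_getD, hh, Option.getD_some] at hhead; exact hhead
  subst hv'
  refine ⟨hch, hnd, hh, hlen, fun w hw => ⟨?_, (hin w hw).2, ?_⟩, hne, ?_⟩
  · have := hup w hw; rw [hhead, lev_mk] at this; exact this
  · obtain ⟨i, hi, rfl⟩ := List.getElem_of_mem hw
    have h0 : b[0]'(by omega) = ((0 : ℤ), (j : ℤ), bb) := by
      rw [List.head?_eq_getElem?, List.getElem?_eq_getElem (by omega), Option.some_inj] at hh; exact hh
    have := abs_fst_sub_le hch (Nat.zero_le i) hi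
    rw [h0] at this
    simp only [sub_zero, Nat.cast_zero] at this
    exact this.trans (by exact_mod_cast (by omega : i ≤ N))
  · rw [List.getLast?_eq_some_getLast hne, Option.some_inj] at hu
    rw [hu]; exact hlev

/-- Head type `0`: shifting down `j` rows gives a bridge of `S_{T−j,N}`, with `wgt = x_c⁻¹ · brTerm`.
[cite: DuminilCopinSmirnov2012, §3 ("The partition function of bridges of width T is B_T")] -/
theorem shift_mem_bridgeLists_false {b : List HV} (hb : b ∈ wbTo T N) {y : ℝ} {j : ℕ} (hj : j < T)
    (hhead : b.headD hvOrigin = ((0 : ℤ), (j : ℤ), false)) :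
    b.map (shift 0 (-(j : ℤ))) ∈ bridgeLists (T - j) N ∧
      wgt T y b = hexCriticalFugacity⁻¹ * brTerm (T - j) y (b.map (shift 0 (-(j : ℤ)))) := by
  have hx := hexCriticalFugacity_pos_lt_one.1
  obtain ⟨hch, hnd, hh, hlen, hbd, hne, hlast⟩ := wbTo_anatomy hb hhead
  have hTj : ((T - j : ℕ) : ℤ) = (T : ℤ) - j := by push_cast [hj.le]; ring
  have hlevs : ∀ w : HV, lev (shift 0 (-(j : ℤ)) w) = lev w - 2 * j := fun w => by rw [lev_shift]; ring
  constructor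
  · rw [mem_bridgeLists_iff (by omega)]
    refine ⟨?_, ?_, hnd.map (shift _ _).injective, fun x hx' => ?_, by simpa using hne, ?_⟩
    · rw [List.isChain_map]; exact hch.imp fun a c h => (shift _ _).map_rel_iff.2 h
    · rw [List.head?_map, hh]; simp [hvOrigin]
    · rw [List.mem_map] at hx'
      obtain ⟨w, hw, rfl⟩ := hx'
      obtain ⟨h1, h2, h3⟩ := hbd w hw
      simp only [bit_false, add_zero] at h1
      refine mem_stripV_of_bounds (by rw [hlevs]; omega) (by rw [hlevs, hTj]; omega) ?_
      simpa using h3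
    · rw [List.getLast_map, hlevs, hlast, hTj]; ring
  · rw [wgt, brTerm, List.length_map, List.filter_map, List.length_map]
    have hpos : 0 < b.length := List.length_pos_iff.2 hne
    have e : (b.filter ((fun v => decide (lev v = 2 * ((T - j : ℕ) : ℤ) - 1)) ∘ (shift 0 (-(j : ℤ))))).length = topCnt T b := by
      unfold topCnt; congr 1
      refine List.filter_congr fun w _ => ?_
      simp only [Function.comp, hlevs, hTj, decide_eq_decide]; omega
    rw [e, ← mul_assoc]
    congr 1
    rw [eq_inv_mul_iff_mul_eq₀ hx.ne', ← pow_succ', Nat.sub_add_cancel hpos]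

/-- Head type `1`: shifting down `j` rows and prepending `O` gives a bridge of `S_{T−j,N}`, with `wgt = x_c⁻² · brTerm`.
[cite: DuminilCopinSmirnov2012, §3 ("The partition function of bridges of width T is B_T")] -/
theorem cons_shift_mem_bridgeLists_true {b : List HV} (hb : b ∈ wbTo T N) {y : ℝ} {j : ℕ} (hj : j < T)
    (hhead : b.headD hvOrigin = ((0 : ℤ), (j : ℤ), true)) :
    hvOrigin :: b.map (shift 0 (-(j : ℤ))) ∈ bridgeLists (T - j) N ∧
      wgt T y b = hexCriticalFugacity⁻¹ ^ 2 * brTerm (T - j) y (hvOrigin :: b.map (shift 0 (-(j : ℤ)))) := by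
  have hx := hexCriticalFugacity_pos_lt_one.1
  obtain ⟨hch, hnd, hh, hlen, hbd, hne, hlast⟩ := wbTo_anatomy hb hhead
  have hTj : ((T - j : ℕ) : ℤ) = (T : ℤ) - j := by push_cast [hj.le]; ring
  have hlevs : ∀ w : HV, lev (shift 0 (-(j : ℤ)) w) = lev w - 2 * j := fun w => by rw [lev_shift]; ring
  have hmne : b.map (shift 0 (-(j : ℤ))) ≠ [] := by simpa using hne
  constructor
  · rw [mem_bridgeLists_iff (by omega)]
    refine ⟨?_, rfl, ?_, fun x hx' => ?_, List.cons_ne_nil _ _, ?_⟩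
    · rw [List.isChain_cons]
      refine ⟨fun c hc => ?_, ?_⟩
      · rw [List.head?_map, hh, Option.map_some, Option.mem_def, Option.some_inj] at hc
        subst hc
        simp [hvOrigin, hvGraph_adj, AdjRel]
      · rw [List.isChain_map]; exact hch.imp fun a c h => (shift _ _).map_rel_iff.2 h
    · rw [List.nodup_cons]
      refine ⟨fun hO => ?_, hnd.map (shift _ _).injective⟩
      rw [List.mem_map] at hO
      obtain ⟨w, hw, hwO⟩ := hO
      have h1 := (hbd w hw).1
      have h2 := congrArg lev hwO
      rw [hlevs, lev_hvOrigin] at h2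
      simp only [bit_true] at h1
      omega
    · rcases List.mem_cons.1 hx' with rfl | hx''
      · exact hvOrigin_mem_stripV (by omega)
      · rw [List.mem_map] at hx''
        obtain ⟨w, hw, rfl⟩ := hx''
        obtain ⟨h1, h2, h3⟩ := hbd w hw
        simp only [bit_true] at h1
        refine mem_stripV_of_bounds (by rw [hlevs]; omega) (by rw [hlevs, hTj]; omega) ?_
        simpa using h3
    · rw [List.getLast_cons hmne, List.getLast_map, hlevs, hlast, hTj]; ring
  · rw [wgt, brTerm, List.length_cons, List.length_map]
    have hpos : 0 < b.length := List.length_pos_iff.2 hne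
    have hO : ¬ (lev hvOrigin = 2 * ((T - j : ℕ) : ℤ) - 1) := by rw [lev_hvOrigin, hTj]; omega
    rw [List.filter_cons_of_neg (by simpa using hO), List.filter_map, List.length_map]
    have e : (b.filter ((fun v => decide (lev v = 2 * ((T - j : ℕ) : ℤ) - 1)) ∘ (shift 0 (-(j : ℤ))))).length = topCnt T b := by
      unfold topCnt; congr 1
      refine List.filter_congr fun w _ => ?_
      simp only [Function.comp, hlevs, hTj, decide_eq_decide]; omega
    rw [e, ← mul_assoc]
    congr 1
    rw [inv_pow, eq_inv_mul_iff_mul_eq₀ (pow_ne_zero _ hx.ne'), ← pow_add]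
    congr 1; omega

/-- **Step 3**: `Σ_{b ∈ wbTo} wgt b ≤ 2T · (x_c⁻¹ + x_c⁻²) · K` whenever `B_{h,L}(x_c; y) ≤ K` for all `1 ≤ h ≤ T` and all `L`.
[cite: DuminilCopinSmirnov2012, §3 (bridges of S_{T,L}); BeatonBousquetMelouDeGierDuminilCopinGuttmann2014, §4.2 (boundedness of B_{T,L}(x_c;y))] -/
theorem sum_wbTo_wgt_le (T N : ℕ) {y K : ℝ} (hy : 0 ≤ y) (hK0 : 0 ≤ K)
    (hK : ∀ h, 1 ≤ h → h ≤ T → ∀ L, stripGFy h L (IsBetaDart h) y ≤ K) :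
    ∑ b ∈ wbTo T N, wgt T y b ≤ 2 * T * ((hexCriticalFugacity⁻¹ + hexCriticalFugacity⁻¹ ^ 2) * K) := by
  classical
  have hx := hexCriticalFugacity_pos_lt_one.1
  -- fibre over the head
  have hmaps : ∀ b ∈ wbTo T N, b.headD hvOrigin ∈ stdHeads T := by
    intro b hb
    rw [wbTo, mem_filter, upTo, mem_filter] at hb
    obtain ⟨hch, hnd, hne, hlen, ⟨v, hh, hv⟩, hin⟩ := mem_allTo_iff.1 hb.1.1
    rw [List.headD_eq_head?_getD, hh, Option.getD_some]
    exact mem_stdHeads_iff.2 ⟨hv, hin v (List.mem_of_mem_head? hh)⟩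
  rw [← sum_fiberwise_of_maps_to hmaps]
  have hfib : ∀ v ∈ stdHeads T, ∑ b ∈ (wbTo T N).filter (fun b => b.headD hvOrigin = v), wgt T y b ≤
      (hexCriticalFugacity⁻¹ + hexCriticalFugacity⁻¹ ^ 2) * K := by
    intro v hv
    rw [stdHeads, mem_image] at hv
    obtain ⟨⟨j, bb⟩, hjb, rfl⟩ := hv
    rw [mem_product, mem_range] at hjb
    obtain ⟨hj', -⟩ := hjb
    have hj : j < T := by simpa using hj'
    have hB : ∑ l ∈ bridgeLists (T - j) N, brTerm (T - j) y l ≤ K := by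
      have := hK (T - j) (by omega) (Nat.sub_le T j) N
      rw [stripGFy_beta_eq_sum_bridgeLists (by omega)] at this
      simpa only [brTerm] using this
    have hbr0 : ∀ l ∈ bridgeLists (T - j) N, 0 ≤ brTerm (T - j) y l := fun l _ =>
      mul_nonneg (pow_nonneg hx.le _) (pow_nonneg hy _)
    have hi1 : 0 ≤ hexCriticalFugacity⁻¹ := inv_nonneg.2 hx.le
    cases bb
    · -- type `0` head
      calc ∑ b ∈ (wbTo T N).filter (fun b => b.headD hvOrigin = ((0 : ℤ), (j : ℤ), false)), wgt T y b
          = ∑ b ∈ (wbTo T N).filter (fun b => b.headD hvOrigin = ((0 : ℤ), (j : ℤ), false)),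
              hexCriticalFugacity⁻¹ * brTerm (T - j) y (b.map (shift 0 (-(j : ℤ)))) :=
            sum_congr rfl fun b hb => (shift_mem_bridgeLists_false (mem_filter.1 hb).1 hj (mem_filter.1 hb).2).2
        _ ≤ ∑ l ∈ bridgeLists (T - j) N, hexCriticalFugacity⁻¹ * brTerm (T - j) y l := by
            refine sum_le_sum_of_injOn_of_nonneg (fun b => b.map (shift 0 (-(j : ℤ)))) ?_
              (fun b hb => (shift_mem_bridgeLists_false (y := y) (mem_filter.1 hb).1 hj (mem_filter.1 hb).2).1)
              (fun l => hexCriticalFugacity⁻¹ * brTerm (T - j) y l) fun l hl => mul_nonneg hi1 (hbr0 l hl)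
            intro b _ b' _ h
            exact (List.map_injective_iff.2 (shift _ _).injective) h
        _ ≤ (hexCriticalFugacity⁻¹ + hexCriticalFugacity⁻¹ ^ 2) * K := by
            rw [← mul_sum]; nlinarith [mul_nonneg (sq_nonneg hexCriticalFugacity⁻¹) hK0]
    · -- type `1` head
      calc ∑ b ∈ (wbTo T N).filter (fun b => b.headD hvOrigin = ((0 : ℤ), (j : ℤ), true)), wgt T y b
          = ∑ b ∈ (wbTo T N).filter (fun b => b.headD hvOrigin = ((0 : ℤ), (j : ℤ), true)),
              hexCriticalFugacity⁻¹ ^ 2 * brTerm (T - j) y (hvOrigin :: b.map (shift 0 (-(j : ℤ)))) :=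
            sum_congr rfl fun b hb => (cons_shift_mem_bridgeLists_true (mem_filter.1 hb).1 hj (mem_filter.1 hb).2).2
        _ ≤ ∑ l ∈ bridgeLists (T - j) N, hexCriticalFugacity⁻¹ ^ 2 * brTerm (T - j) y l := by
            refine sum_le_sum_of_injOn_of_nonneg (fun b => hvOrigin :: b.map (shift 0 (-(j : ℤ)))) ?_
              (fun b hb => (cons_shift_mem_bridgeLists_true (y := y) (mem_filter.1 hb).1 hj (mem_filter.1 hb).2).1)
              (fun l => hexCriticalFugacity⁻¹ ^ 2 * brTerm (T - j) y l) fun l hl => mul_nonneg (sq_nonneg _) (hbr0 l hl)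
            intro b _ b' _ h
            exact (List.map_injective_iff.2 (shift _ _).injective) (List.cons.inj h).2
        _ ≤ (hexCriticalFugacity⁻¹ + hexCriticalFugacity⁻¹ ^ 2) * K := by
            rw [← mul_sum]; nlinarith [mul_nonneg hi1 hK0]
  calc ∑ v ∈ stdHeads T, ∑ b ∈ (wbTo T N).filter (fun b => b.headD hvOrigin = v), wgt T y b
      ≤ ∑ _v ∈ stdHeads T, (hexCriticalFugacity⁻¹ + hexCriticalFugacity⁻¹ ^ 2) * K := sum_le_sum hfib
    _ = (stdHeads T).card * ((hexCriticalFugacity⁻¹ + hexCriticalFugacity⁻¹ ^ 2) * K) := by rw [sum_const, nsmul_eq_mul]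
    _ ≤ 2 * T * ((hexCriticalFugacity⁻¹ + hexCriticalFugacity⁻¹ ^ 2) * K) := by
        refine mul_le_mul_of_nonneg_right ?_ (by positivity)
        exact_mod_cast card_stdHeads_le T

/-! #### Assembly: a uniform bound on `Σ_{n ≤ N} x_cⁿ Z_n(y)` and `ν_T(y) ≤ x_c⁻¹` -/

/-- `Σ_{n ≤ N} x_cⁿ Z_n(y) = Σ_{c ∈ allTo T N} wgt c`. [cite: BeatonBousquetMelouDeGierDuminilCopinGuttmann2014, Proposition 6 (arXiv v5 p. 10)] -/
theorem sum_pow_mul_stripZL_eq (T N : ℕ) (y : ℝ) :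
    ∑ n ∈ range (N + 1), hexCriticalFugacity ^ n * stripZL T n y = ∑ c ∈ allTo T N, wgt T y c := by
  rw [allTo, sum_biUnion fun n _ n' _ hnn => disjoint_stripChains T hnn]
  refine sum_congr rfl fun n _ => ?_
  rw [stripZL, mul_sum]
  refine sum_congr rfl fun c hc => ?_
  rw [wgt, (mem_stripChains_iff.1 hc).2.2.1, Nat.add_sub_cancel]

/-- **The uniform bound**: if `B_{h,L}(x_c; y) ≤ K` for all `1 ≤ h ≤ T`, `L`, then for every `N`
`Σ_{n ≤ N} x_cⁿ Z_n(y) ≤ max(1,y⁻¹) · (2T G₀ (1 + 2T (x_c⁻¹ + x_c⁻²) K))²`.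
[cite: DuminilCopinSmirnov2012, §3 ("Z(x) ≤ … ∏ (1 + B_T^x)²", here inside a strip: finitely many factors); BeatonBousquetMelouDeGierDuminilCopinGuttmann2014, Corollary 8 (arXiv v5 p. 12)] -/
theorem sum_pow_mul_stripZL_le {T : ℕ} (hT : 1 ≤ T) {y K : ℝ} (hy : 0 < y) (hK0 : 0 ≤ K)
    (hK : ∀ h, 1 ≤ h → h ≤ T → ∀ L, stripGFy h L (IsBetaDart h) y ≤ K) (N : ℕ) :
    ∑ n ∈ range (N + 1), hexCriticalFugacity ^ n * stripZL T n y ≤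
      HexBW.yK y * (2 * T * G0 T * (1 + 2 * T * ((hexCriticalFugacity⁻¹ + hexCriticalFugacity⁻¹ ^ 2) * K))) ^ 2 := by
  have hx := hexCriticalFugacity_pos_lt_one.1
  have hKy := HexBW.one_le_yK y
  have hA := sum_allTo_pow_le hT N
  have hA0 : 0 ≤ ∑ c ∈ allTo T N, hexCriticalFugacity ^ (c.length - 1) := sum_nonneg fun _ _ => pow_nonneg hx.le _
  have hW := sum_wbTo_wgt_le T N hy.le hK0 hK
  have hW0 : 0 ≤ ∑ b ∈ wbTo T N, wgt T y b := sum_nonneg fun _ _ => wgt_nonneg T hy.le _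
  have hU := sum_upTo_wgt_le T N hy.le
  have hU0 : 0 ≤ ∑ p ∈ upTo T N, wgt T y p := sum_nonneg fun _ _ => wgt_nonneg T hy.le _
  rw [sum_pow_mul_stripZL_eq]
  refine (sum_allTo_wgt_le T N hy).trans (mul_le_mul_of_nonneg_left ?_ (by linarith))
  refine pow_le_pow_left₀ hU0 (hU.trans ?_) 2
  exact mul_le_mul hA (by linarith) (by linarith) (mul_nonneg (by positivity) (G0_nonneg T))

/-- **`ν_T(y) ≤ x_c⁻¹` whenever the bridge classes `B_h(x_c; y)`, `1 ≤ h ≤ T`, are bounded in `L`** (`y > 0`).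
[cite: BeatonBousquetMelouDeGierDuminilCopinGuttmann2014, Corollary 8 (arXiv v5 p. 12: "ρ_T(y) > ρ_T(y_T) ⟺ y < y_T", ρ_T = 1/μ_T); lane: weak form via the finite bridge decomposition in the strip] -/
theorem stripNu_le_inv_of_bdd {T : ℕ} (hT : 1 ≤ T) {y K : ℝ} (hy : 0 < y) (hK0 : 0 ≤ K)
    (hK : ∀ h, 1 ≤ h → h ≤ T → ∀ L, stripGFy h L (IsBetaDart h) y ≤ K) :
    stripNu T y ≤ hexCriticalFugacity⁻¹ := by
  have hx := hexCriticalFugacity_pos_lt_one.1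
  have hKy := HexBW.one_le_yK y
  have hν := stripNu_pos hT hy
  set C := HexBW.yK y * (2 * T * G0 T * (1 + 2 * T * ((hexCriticalFugacity⁻¹ + hexCriticalFugacity⁻¹ ^ 2) * K))) ^ 2
  -- `(ν x_c)ⁿ ≤ yK · C` for every `n`
  have hbd : ∀ n : ℕ, (stripNu T y * hexCriticalFugacity) ^ n ≤ HexBW.yK y * C := by
    intro n
    have h1 := pow_stripNu_le hT n hy hν.le
    have h2 : hexCriticalFugacity ^ n * stripZL T n y ≤ C := by
      refine le_trans ?_ (sum_pow_mul_stripZL_le hT hy hK0 hK n)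
      exact single_le_sum (f := fun k => hexCriticalFugacity ^ k * stripZL T k y)
        (fun k _ => mul_nonneg (pow_nonneg hx.le _) (stripZL_nonneg T k hy.le)) (mem_range.2 (Nat.lt_succ_self n))
    calc (stripNu T y * hexCriticalFugacity) ^ n = stripNu T y ^ n * hexCriticalFugacity ^ n := mul_pow _ _ _
      _ ≤ HexBW.yK y * stripZL T n y * hexCriticalFugacity ^ n := mul_le_mul_of_nonneg_right h1 (pow_nonneg hx.le _)
      _ = HexBW.yK y * (hexCriticalFugacity ^ n * stripZL T n y) := by ring
      _ ≤ HexBW.yK y * C := mul_le_mul_of_nonneg_left h2 (by linarith)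
  have hle : stripNu T y * hexCriticalFugacity ≤ 1 := by
    by_contra hgt
    push Not at hgt
    obtain ⟨n, hn⟩ := (tendsto_pow_atTop_atTop_of_one_lt hgt).eventually_gt_atTop (HexBW.yK y * C) |>.exists
    exact absurd (hbd n) (not_le.2 hn)
  calc stripNu T y = stripNu T y * hexCriticalFugacity * hexCriticalFugacity⁻¹ := by field_simp
    _ ≤ 1 * hexCriticalFugacity⁻¹ := mul_le_mul_of_nonneg_right hle (inv_nonneg.2 hx.le)
    _ = hexCriticalFugacity⁻¹ := one_mul _

/-- **`ν_T(y) ≤ x_c⁻¹` whenever `y ∈ stripBddSet h` for all `1 ≤ h ≤ T`** (`y > 0`).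
[cite: BeatonBousquetMelouDeGierDuminilCopinGuttmann2014, Corollary 8 (arXiv v5 p. 12)] -/
theorem stripNu_le_inv_of_mem {T : ℕ} (hT : 1 ≤ T) {y : ℝ} (hy : 0 < y)
    (hmem : ∀ h, 1 ≤ h → h ≤ T → y ∈ stripBddSet h) : stripNu T y ≤ hexCriticalFugacity⁻¹ := by
  -- a common bound: the sum of the suprema
  have hb : ∀ h ∈ Finset.Icc 1 T, BddAbove (Set.range fun L : ℕ => stripGFy h L (IsBetaDart h) y) := fun h hh =>
    (hmem h (Finset.mem_Icc.1 hh).1 (Finset.mem_Icc.1 hh).2).2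
  set K := ∑ h ∈ Finset.Icc 1 T, ⨆ L : ℕ, stripGFy h L (IsBetaDart h) y with hK
  have hKh : ∀ h ∈ Finset.Icc 1 T, 0 ≤ ⨆ L : ℕ, stripGFy h L (IsBetaDart h) y := fun h hh =>
    le_ciSup_of_le (hb h hh) 0 (stripGFy_nonneg' h 0 _ hy.le)
  have hK0 : 0 ≤ K := sum_nonneg hKh
  refine stripNu_le_inv_of_bdd hT hy hK0 fun h h1 h2 L => ?_
  have hh : h ∈ Finset.Icc 1 T := Finset.mem_Icc.2 ⟨h1, h2⟩
  exact (le_ciSup (hb h hh) L).trans (single_le_sum (f := fun h => ⨆ L : ℕ, stripGFy h L (IsBetaDart h) y) hKh hh)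

end HW

end Literature.Probability.RandomPlanarGeometry.SAW.HV
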